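import Summits.QuantumFields.YangMills.Theorems.FluctuationComparisonRegPrIntLS2BetaTreeGaugeChartLocalCover
import Summits.QuantumFields.YangMills.Theorems.FluctuationComparisonRegPrIntLS2BetaSignedCombCount
import Literature.MathematicalPhysics.QuantumFieldTheory.Balaban1983to89.T3OrbitAverage
import Literature.MathematicalPhysics.QuantumFieldTheory.Balaban1983to89.FieldMeasureExpChartChangeOfVariables
import Literature.MathematicalPhysics.QuantumFieldTheory.Balaban1983to89.HaarExponentialChartMeasure
import HarnessLib

/-!
# (C3β″) TUBULAR HAAR COORDINATES AROUND AN ORBIT — LOCAL EDITION WITH THE FREE-BOND WINDOW NAMED («WINDOW-ID», (Q-TUBE)(ii))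

Crux `stmt-QuantumFields-20520` (`…Theses.UnitScaleTilt.FluctuationComparisonRegPrIntL`), LINE g18-1 S2β, organ (C3) ∕ DET-REP (B) (Q-TUBE)(ii); cell `ym3-torus`
(HUMAN RULING D-0037 — rung R3, not Clay), width seat `ym3-torus-px21` g17 (lineage of ✓`…TubularChartActLocal`); count-neutral helper
(`--kind proof --supports stmt-QuantumFields-20520 --as helper`).  Theorems only: 0 `def`, 0 `instance`, 0 `notation`, 0 `sorry`.
WHY.  ymfull-r3-prover-4 g0's (Q-TUBE) algebra ✓`…S2BetaSliceOfCombForm` displays WINDOW-ID `hWin : ∀ y, (∀ b, ‖(eV y)_b‖ < r) → y ∈ UV` for the tube of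
record; the landed lattice chart ✓`exists_tubularHaarChart_act_local` exports `UV` only as SOME open window.  This twin re-runs it VERBATIM over the root
edition with the window named (✓`…TreeGaugeChartLocalCover.exists_tubularChart_of_treeGauge_local_cover`, row (F5)) and appends ONE conjunct:
(F5) `UV = eV ⁻¹' B(0, s∕2)` with `s = IsChartRep.chartRadius (specialUnitaryLogChart (Fin 2))` — the ONE-BOND chart radius (`= log(4∕3)`), DEPTH-UNIFORM.
and (F6) the COVER row in lattice currency: a fine field `V'` whose BIG-comb axial readings relative to `U₀` off comb ∪ pivots,
`(T₀(b₋) U₀(b) T₀(b₊)⁻¹)⁻¹ · (T_{V'}(b₋) V'(b) T_{V'}(b₊)⁻¹)` (`T = combTransporter k`), lie in the canonical window `Θ(B(0, s∕2))` IS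
`extend ι (c ↦ V'(ι c) U₀(ι c)⁻¹ · σ y (ι c)) (((T_{V'})⁻¹ T_{U₀}) • σ y)` for some `y ∈ UV` — the action of record with an EXPLICIT residual∕pivot pair.
WHAT.  ★★★ `exists_tubularHaarChart_act_local_winId` = every row of ✓`exists_tubularHaarChart_act_local` VERBATIM (same binders, same order) + (F5) + (F6) last.
HONEST SCOPE.  A chart-side re-export; nothing of (Q-TUBE)∕DET-REP (B)∕LIMIT∕(CT)∕S2β∕crux 20520 is proved here; rung R3 — NOT d = 4, NOT infinite volume,
NOT a mass gap, NOT Clay.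
[cite: Helgason2000, Ch. I §1 Thm 1.14 (13) p. 96; Balaban1985Averaging, (8), (10) p.18; Balaban1985Variational, Thm 1 (8)-(10) p.279; Balaban1985UV3, (18) p.260]
-/

noncomputable section

open MeasureTheory MeasureTheory.Measure Filter Topology Set Function
open scoped ENNReal Matrix.Norms.L2Operator
open Literature.MathematicalPhysics.QuantumFieldTheory.Balaban1983to89
open Literature.MathematicalPhysics.QuantumFieldTheory.Balaban1983to89.B12GaugeOrbits021 (IsResidual)
open Literature.MathematicalPhysics.QuantumFieldTheory.Balaban1983to89.HaarExponentialChart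
open Literature.MathematicalPhysics.QuantumFieldTheory.Balaban1983to89.LogChartProduct
open Literature.MathematicalPhysics.QuantumFieldTheory.Balaban1983to89.T4RootedResidualGauge (rootOf rootOf_embIter)
open Literature.MathematicalPhysics.QuantumFieldTheory.Balaban1983to89.B15DeterminingSets (embIter)
open Literature.MathematicalPhysics.QuantumFieldTheory.Balaban1983to89.B14.Eq22Determines (blockIter)
open Literature.MathematicalPhysics.QuantumFieldTheory.Balaban1983to89.B15Eq177GaugeInvariance (blockIter_embIter)
open scoped Literature.MathematicalPhysics.QuantumFieldTheory.Balaban1983to89.T3OrbitAverage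
open Summit.QuantumFields.YangMills.Theorems.FluctuationComparisonRegPrIntLWregChain (iterCentralBond iterCentralBond_injective)
open Summit.QuantumFields.YangMills.Theorems.FluctuationComparisonRegPrIntLS2BetaTreeGaugeChartLocalCover
open Literature.MathematicalPhysics.QuantumFieldTheory.Balaban1983to89.B13HaarSigmaJacobian (jac)
open Summit.QuantumFields.YangMills.Theorems.FluctuationComparisonRegPrIntLS2BetaSignedComb
open Summit.QuantumFields.YangMills.Theorems.FluctuationComparisonRegPrIntLS2BetaSignedCombKill
open Summit.QuantumFields.YangMills.Theorems.FluctuationComparisonRegPrIntLS2BetaSignedCombCount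

namespace Summit.QuantumFields.YangMills.Theorems.FluctuationComparisonRegPrIntLS2BetaTubularChartActLocalWinId

set_option maxHeartbeats 400000 in
/-- ★★★ **(C3β″) TUBULAR HAAR COORDINATES AROUND AN ORBIT OF `K₀ × SU(2)^{pivots}`, LOCAL EDITION, FREE-BOND WINDOW NAMED** — every row of
✓`…TubularChartActLocal.exists_tubularHaarChart_act_local` VERBATIM plus the LAST two conjuncts (F5) «WINDOW-ID»
`UV = eV ⁻¹' Metric.ball 0 (IsChartRep.chartRadius (specialUnitaryLogChart (Fin 2)) ∕ 2)` (the one-bond chart radius, depth-uniform) and (F6) «COVER» (a field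
with big-comb axial readings relative to `U₀` in `Θ(B(0, s∕2))` off comb ∪ pivots IS the action of record of `((T_{V'})⁻¹ T_{U₀}, V'(ι ·) U₀(ι ·)⁻¹)` on some
`σ y`, `y ∈ UV`).  PARENT: (letter v2.1 with the window, density and
openness exported in product form, the free-bond frame `eV` exported, (F4a) the bondwise formula of `σ` and (F4b′) `jV = σ₀·|det jac(eV ·)|`).  Setting of w5-20520 g13's (β″): the fine fields `X = SU(2)^{bonds}` with product Haar `dU`; the group
`Kg = K₀ × SU(2)^{PBond P k}` (`K₀` = level-`k` residual = root-trivial transformations, `k := K − J`) acting by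
`ACT (w, hp) U := extend (iterCentralBond k) (c ↦ hp c · U (iterCentralBond k c)) (w • U)`.  For every base point `U₀`: Euclidean models of dimensions `dZ`, `dV`,
a group chart `e = (e_res, e_piv)` onto a neighbourhood of `1` among the residual pairs, a smooth transversal `σ` through `U₀` with (A0)(A1)(A2), OPEN WINDOWS
`UZ ∋ 0`, `UV ∋ 0` with `closedBall 0 ρ₀ ⊆ UZ` (F1), the tube map `Θ'(z, y) = ACT (e z) (σ y)` injective on `UZ ×ˢ UV`, open at the origin AND AT EVERY POINT OF
`UZ ×ˢ UV` (F3), continuous densities `jZ, jV ≥ 0` positive at `0` (F2), and the chart identity `dU|_{Θ'(UZ × UV)} = Θ'_*((jZ ⊗ jV · dz ⊗ dy)|_{UZ × UV})`.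
[cite: Helgason2000, Ch. I §1 Thm 1.14 (13) p. 96; Balaban1985Averaging, (8), (10) p.18; Balaban1985Variational, Thm 1 (8)-(10) p.279] -/
theorem exists_tubularHaarChart_act_local_winId (P : Params) {k : ℕ} (hk : k ≤ P.m + P.K)
    [DecidablePred (· ∈ (combSet k : Set (PBond P 0)) ∪ Set.range (iterCentralBond (P := P) k))] (dZ dV : ℕ)
    (hdZ : dZ = Module.finrank ℝ (specialUnitaryLogChart (Fin 2)).lie *
      ((Fintype.card (Site P 0) - Fintype.card (Site P k)) + Fintype.card (PBond P k)))
    (hdV : dV = Module.finrank ℝ (specialUnitaryLogChart (Fin 2)).lie * (Fintype.card (PBond P 0) - Fintype.card (PBond P k)) -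
      Module.finrank ℝ (specialUnitaryLogChart (Fin 2)).lie * (Fintype.card (Site P 0) - Fintype.card (Site P k)))
    (U₀ : GaugeField P 0 (Matrix.specialUnitaryGroup (Fin 2) ℂ)) :
    ∃ (e : EuclideanSpace ℝ (Fin dZ) →
          (Site P 0 → Matrix.specialUnitaryGroup (Fin 2) ℂ) × (PBond P k → Matrix.specialUnitaryGroup (Fin 2) ℂ))
      (σ : EuclideanSpace ℝ (Fin dV) → GaugeField P 0 (Matrix.specialUnitaryGroup (Fin 2) ℂ))
      (eV : EuclideanSpace ℝ (Fin dV) ≃L[ℝ] (piLogChart (specialUnitaryLogChart (Fin 2)) {b : PBond P 0 // b ∉ (combSet k : Set (PBond P 0)) ∪ Set.range (iterCentralBond (P := P) k)}).lie)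
      (UZ : Set (EuclideanSpace ℝ (Fin dZ))) (UV : Set (EuclideanSpace ℝ (Fin dV)))
      (jZ : EuclideanSpace ℝ (Fin dZ) → ℝ) (jV : EuclideanSpace ℝ (Fin dV) → ℝ) (ρ₀ : ℝ),
      Continuous e ∧ e 0 = 1 ∧ (∀ z, IsResidual k (e z).1) ∧
      (∀ s ∈ 𝓝 (0 : EuclideanSpace ℝ (Fin dZ)),
        ∃ t ∈ 𝓝 ((1 : Site P 0 → Matrix.specialUnitaryGroup (Fin 2) ℂ), (1 : PBond P k → Matrix.specialUnitaryGroup (Fin 2) ℂ)),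
          ∀ w ∈ t, IsResidual k w.1 → w ∈ e '' s) ∧
      Continuous σ ∧ σ 0 = U₀ ∧
      ContDiff ℝ ⊤ (fun y : EuclideanSpace ℝ (Fin dV) => fun b : PBond P 0 =>
        ((σ y b : Matrix.specialUnitaryGroup (Fin 2) ℂ) : Matrix (Fin 2) (Fin 2) ℂ)) ∧
      (∀ y, ∀ b ∈ (combSet k : Set (PBond P 0)) ∪ Set.range (iterCentralBond (P := P) k), σ y b = U₀ b) ∧
      (∀ y, combTransporter k (σ y) = combTransporter k U₀) ∧
      (∀ y (b : PBond P 0) (hb : b ∉ (combSet k : Set (PBond P 0)) ∪ Set.range (iterCentralBond (P := P) k)),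
        σ y b = U₀ b * ((combTransporter k U₀ b.tgt)⁻¹ *
          (isChartRep_specialUnitaryGroup (n := Fin 2)).expChart
            (lieApply (specialUnitaryLogChart (Fin 2)) {b : PBond P 0 // b ∉ (combSet k : Set (PBond P 0)) ∪ Set.range (iterCentralBond (P := P) k)} (eV y) ⟨b, hb⟩) *
          combTransporter k U₀ b.tgt)) ∧
      (∃ c : ℝ, 0 < c ∧ ∀ᶠ y in 𝓝 (0 : EuclideanSpace ℝ (Fin dV)),
        c * ‖y‖ ^ 2 ≤ ∑ b : PBond P 0, dist1 (σ y b * (U₀ b)⁻¹) ^ 2) ∧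
      IsOpen UZ ∧ IsOpen UV ∧ (0 : EuclideanSpace ℝ (Fin dZ)) ∈ UZ ∧ (0 : EuclideanSpace ℝ (Fin dV)) ∈ UV ∧
      0 < ρ₀ ∧ Metric.closedBall (0 : EuclideanSpace ℝ (Fin dZ)) ρ₀ ⊆ UZ ∧
      InjOn (fun p : EuclideanSpace ℝ (Fin dZ) × EuclideanSpace ℝ (Fin dV) =>
            Function.extend (iterCentralBond (P := P) k) (fun c => (e p.1).2 c * σ p.2 (iterCentralBond (P := P) k c))
              (GaugeField.gaugeAct (e p.1).1 (σ p.2))) (UZ ×ˢ UV) ∧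
      (∀ s ∈ 𝓝 ((0 : EuclideanSpace ℝ (Fin dZ)), (0 : EuclideanSpace ℝ (Fin dV))),
          (fun p : EuclideanSpace ℝ (Fin dZ) × EuclideanSpace ℝ (Fin dV) =>
            Function.extend (iterCentralBond (P := P) k) (fun c => (e p.1).2 c * σ p.2 (iterCentralBond (P := P) k c))
              (GaugeField.gaugeAct (e p.1).1 (σ p.2))) '' s ∈ 𝓝 U₀) ∧
      (∀ p ∈ UZ ×ˢ UV, ∀ s ∈ 𝓝 p,
          (fun p : EuclideanSpace ℝ (Fin dZ) × EuclideanSpace ℝ (Fin dV) =>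
            Function.extend (iterCentralBond (P := P) k) (fun c => (e p.1).2 c * σ p.2 (iterCentralBond (P := P) k c))
              (GaugeField.gaugeAct (e p.1).1 (σ p.2))) '' s ∈
            𝓝 ((fun p : EuclideanSpace ℝ (Fin dZ) × EuclideanSpace ℝ (Fin dV) =>
            Function.extend (iterCentralBond (P := P) k) (fun c => (e p.1).2 c * σ p.2 (iterCentralBond (P := P) k c))
              (GaugeField.gaugeAct (e p.1).1 (σ p.2))) p)) ∧
      Continuous jZ ∧ Continuous jV ∧ (∀ z, 0 ≤ jZ z) ∧ (∀ y, 0 ≤ jV y) ∧ 0 < jZ 0 ∧ 0 < jV 0 ∧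
      (∃ σ₀ : ℝ, 0 < σ₀ ∧ ∀ y, jV y = σ₀ * |LinearMap.det
        (jac (lie_adStable_pi (specialUnitaryLogChart (Fin 2)) {b : PBond P 0 // b ∉ (combSet k : Set (PBond P 0)) ∪ Set.range (iterCentralBond (P := P) k)}
            (lie_adStable_specialUnitaryGroup (n := Fin 2))) (eV y) :
          (piLogChart (specialUnitaryLogChart (Fin 2)) {b : PBond P 0 // b ∉ (combSet k : Set (PBond P 0)) ∪ Set.range (iterCentralBond (P := P) k)}).lie →ₗ[ℝ]
          (piLogChart (specialUnitaryLogChart (Fin 2)) {b : PBond P 0 // b ∉ (combSet k : Set (PBond P 0)) ∪ Set.range (iterCentralBond (P := P) k)}).lie)|) ∧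
      (fieldMeasure P 0 (Matrix.specialUnitaryGroup (Fin 2) ℂ)).restrict
          ((fun p : EuclideanSpace ℝ (Fin dZ) × EuclideanSpace ℝ (Fin dV) =>
            Function.extend (iterCentralBond (P := P) k) (fun c => (e p.1).2 c * σ p.2 (iterCentralBond (P := P) k c))
              (GaugeField.gaugeAct (e p.1).1 (σ p.2))) '' (UZ ×ˢ UV)) =
        ((((volume : Measure (EuclideanSpace ℝ (Fin dZ))).prod (volume : Measure (EuclideanSpace ℝ (Fin dV)))).restrict (UZ ×ˢ UV)).withDensity
            (fun w => ENNReal.ofReal (jZ w.1 * jV w.2))).map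
          (fun p : EuclideanSpace ℝ (Fin dZ) × EuclideanSpace ℝ (Fin dV) =>
            Function.extend (iterCentralBond (P := P) k) (fun c => (e p.1).2 c * σ p.2 (iterCentralBond (P := P) k c))
              (GaugeField.gaugeAct (e p.1).1 (σ p.2))) ∧
      UV = eV ⁻¹' Metric.ball (0 : (piLogChart (specialUnitaryLogChart (Fin 2))
        {b : PBond P 0 // b ∉ (combSet k : Set (PBond P 0)) ∪ Set.range (iterCentralBond (P := P) k)}).lie)
        (IsChartRep.chartRadius (specialUnitaryLogChart (Fin 2)) / 2) ∧
      (∀ V' : GaugeField P 0 (Matrix.specialUnitaryGroup (Fin 2) ℂ),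
        (∀ (b : PBond P 0) (hb : b ∉ (combSet k : Set (PBond P 0)) ∪ Set.range (iterCentralBond (P := P) k)),
          (combTransporter k U₀ b.src * U₀ b * (combTransporter k U₀ b.tgt)⁻¹)⁻¹ *
              (combTransporter k V' b.src * V' b * (combTransporter k V' b.tgt)⁻¹) ∈
            (isChartRep_specialUnitaryGroup (n := Fin 2)).window (IsChartRep.chartRadius (specialUnitaryLogChart (Fin 2)) / 2)) →
        ∃ y ∈ UV, V' = Function.extend (iterCentralBond (P := P) k)
            (fun c => V' (iterCentralBond (P := P) k c) * (U₀ (iterCentralBond (P := P) k c))⁻¹ * σ y (iterCentralBond (P := P) k c))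
            (GaugeField.gaugeAct (fun x => (combTransporter k V' x)⁻¹ * combTransporter k U₀ x) (σ y))) := by
  -- the group, its chart and its Haar probability measure
  haveI : FiniteDimensional ℝ (Matrix (Fin 2) (Fin 2) ℂ) := FiniteDimensional.complexToReal _
  haveI : (HaarData.haar : Measure (Matrix.specialUnitaryGroup (Fin 2) ℂ)).IsHaarMeasure :=
    FieldMeasureExpChartChangeOfVariables.isHaarMeasure_haar_specialUnitaryGroup (N := 2)
  have hch := isChartRep_specialUnitaryGroup (n := Fin 2)
  have hlie := lie_adStable_specialUnitaryGroup (n := Fin 2)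
  -- the pivots
  have hιinj : Injective (iterCentralBond (P := P) k) := iterCentralBond_injective hk
  have hembinj : Injective (embIter k : Site P k → Site P 0) := Function.LeftInverse.injective (blockIter_embIter k hk)
  -- the extended lattice: one virtual site `inr c` per pivot
  set s' : PBond P 0 → Site P 0 ⊕ PBond P k :=
    Function.extend (iterCentralBond (P := P) k) (fun c => Sum.inr c) (fun b => Sum.inl b.src) with hs'
  set t' : PBond P 0 → Site P 0 ⊕ PBond P k :=
    Function.extend (iterCentralBond (P := P) k) (fun c => Sum.inl (rootOf k (iterCentralBond (P := P) k c).tgt))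
      (fun b => Sum.inl b.tgt) with ht'
  set R' : Set (Site P 0 ⊕ PBond P k) := Set.range (fun y : Site P k => (Sum.inl (embIter k y) : Site P 0 ⊕ PBond P k)) with hR'
  -- the killed bonds: comb ∪ pivots (a `let`, NOT a `set`: the statement's `DecidablePred` binder must stay the one instance of record)
  let F' : Set (PBond P 0) := (combSet k : Set (PBond P 0)) ∪ Set.range (iterCentralBond (P := P) k)
  have hF' : F' = (combSet k : Set (PBond P 0)) ∪ Set.range (iterCentralBond (P := P) k) := rfl
  letI : DecidablePred (· ∈ F') := ‹DecidablePred (· ∈ (combSet k : Set (PBond P 0)) ∪ Set.range (iterCentralBond (P := P) k))›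
  set g' : (PBond P 0 → Matrix.specialUnitaryGroup (Fin 2) ℂ) → (Site P 0 ⊕ PBond P k → Matrix.specialUnitaryGroup (Fin 2) ℂ) :=
    fun V => Sum.elim (fun x => combTransporter k V x) (fun c => (V (iterCentralBond (P := P) k c))⁻¹) with hg'
  have hs'piv : ∀ c, s' (iterCentralBond (P := P) k c) = Sum.inr c := fun c => hιinj.extend_apply _ _ c
  have ht'piv : ∀ c, t' (iterCentralBond (P := P) k c) = Sum.inl (rootOf k (iterCentralBond (P := P) k c).tgt) :=
    fun c => hιinj.extend_apply _ _ c
  have hs'off : ∀ b, b ∉ Set.range (iterCentralBond (P := P) k) → s' b = Sum.inl b.src :=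
    fun b hb => Function.extend_apply' _ _ b hb
  have ht'off : ∀ b, b ∉ Set.range (iterCentralBond (P := P) k) → t' b = Sum.inl b.tgt :=
    fun b hb => Function.extend_apply' _ _ b hb
  have hrootR : ∀ x : Site P 0, (Sum.inl (rootOf k x) : Site P 0 ⊕ PBond P k) ∈ R' := fun x => ⟨blockIter k x, rfl⟩
  have hcombOff : ∀ b ∈ (combSet k : Set (PBond P 0)), b ∉ Set.range (iterCentralBond (P := P) k) :=
    fun b hb ⟨c, hc⟩ => iterCentralBond_not_mem_combSet hk c (hc ▸ hb)
  -- Borel structures and frames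
  letI : MeasurableSpace (piLogChart (specialUnitaryLogChart (Fin 2)) {x : Site P 0 ⊕ PBond P k // x ∉ R'}).lie := borel _
  haveI : BorelSpace (piLogChart (specialUnitaryLogChart (Fin 2)) {x : Site P 0 ⊕ PBond P k // x ∉ R'}).lie := ⟨rfl⟩
  letI : MeasurableSpace (piLogChart (specialUnitaryLogChart (Fin 2)) {b : PBond P 0 // b ∉ F'}).lie := borel _
  haveI : BorelSpace (piLogChart (specialUnitaryLogChart (Fin 2)) {b : PBond P 0 // b ∉ F'}).lie := ⟨rfl⟩
  haveI := finiteDimensional_piLogChart_lie (specialUnitaryLogChart (Fin 2)) {x : Site P 0 ⊕ PBond P k // x ∉ R'}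
  haveI := finiteDimensional_piLogChart_lie (specialUnitaryLogChart (Fin 2)) {b : PBond P 0 // b ∉ F'}
  have hfr : ∀ (B : Type) [Fintype B], Module.finrank ℝ (piLogChart (specialUnitaryLogChart (Fin 2)) B).lie =
      Fintype.card B * Module.finrank ℝ (specialUnitaryLogChart (Fin 2)).lie := by
    intro B _
    rw [LinearEquiv.finrank_eq (lieEquivPi (specialUnitaryLogChart (Fin 2)) B), Module.finrank_pi_fintype, Finset.sum_const,
      Finset.card_univ, smul_eq_mul]
  -- cardinalities
  have hcardR : Fintype.card {x : Site P 0 ⊕ PBond P k // x ∉ R'} =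
      (Fintype.card (Site P 0) - Fintype.card (Site P k)) + Fintype.card (PBond P k) := by
    have hinj : Injective (fun y : Site P k => (Sum.inl (embIter k y) : Site P 0 ⊕ PBond P k)) :=
      Sum.inl_injective.comp hembinj
    have h1 : Nat.card {x : Site P 0 ⊕ PBond P k // x ∉ R'} = Nat.card (Site P 0 ⊕ PBond P k) - R'.ncard := by
      rw [← Set.ncard_compl R', ← Nat.card_coe_set_eq]; rfl
    have h2 : R'.ncard = Fintype.card (Site P k) := by
      rw [← Nat.card_coe_set_eq, hR', Nat.card_range_of_injective hinj, Nat.card_eq_fintype_card]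
    have hle : Fintype.card (Site P k) ≤ Fintype.card (Site P 0) := Fintype.card_le_of_injective _ hembinj
    rw [← Nat.card_eq_fintype_card, h1, h2, Nat.card_sum, Nat.card_eq_fintype_card, Nat.card_eq_fintype_card]
    omega
  have hcardF : Fintype.card {b : PBond P 0 // b ∉ F'} =
      (Fintype.card (PBond P 0) - Fintype.card (PBond P k)) - (Fintype.card (Site P 0) - Fintype.card (Site P k)) := by
    have h1 : Nat.card {b : PBond P 0 // b ∉ F'} = Nat.card (PBond P 0) - F'.ncard := by
      rw [← Set.ncard_compl F', ← Nat.card_coe_set_eq]; rfl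
    have h2 : F'.ncard = (Fintype.card (Site P 0) - Fintype.card (Site P k)) + Fintype.card (PBond P k) := by
      rw [hF', Set.ncard_union_eq (Set.disjoint_left.2 fun b hb hb' => hcombOff b hb hb'), ← Nat.card_coe_set_eq,
        nat_card_combSet hk, ← Nat.card_coe_set_eq, Nat.card_range_of_injective hιinj, Nat.card_eq_fintype_card]
    rw [← Nat.card_eq_fintype_card, h1, h2, Nat.card_eq_fintype_card]
    omega
  obtain ⟨eZ⟩ : Nonempty (EuclideanSpace ℝ (Fin dZ) ≃L[ℝ]
      (piLogChart (specialUnitaryLogChart (Fin 2)) {x : Site P 0 ⊕ PBond P k // x ∉ R'}).lie) :=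
    ⟨ContinuousLinearEquiv.ofFinrankEq (by rw [finrank_euclideanSpace_fin, hfr, hcardR, hdZ, mul_comm])⟩
  obtain ⟨eV⟩ : Nonempty (EuclideanSpace ℝ (Fin dV) ≃L[ℝ] (piLogChart (specialUnitaryLogChart (Fin 2)) {b : PBond P 0 // b ∉ F'}).lie) :=
    ⟨ContinuousLinearEquiv.ofFinrankEq (by
      rw [finrank_euclideanSpace_fin, hfr, hcardF, hdV, Nat.sub_mul, mul_comm (Fintype.card (PBond P 0) - _),
        mul_comm (Fintype.card (Site P 0) - _)])⟩
  -- the six tree-gauge axioms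
  have hgc : Continuous g' := by
    refine continuous_pi fun i => ?_
    rcases i with x | c
    · exact (continuous_apply x).comp (continuous_combTransporter (P := P) (G := Matrix.specialUnitaryGroup (Fin 2) ℂ) k)
    · exact (continuous_apply (iterCentralBond (P := P) k c)).inv
  have hgR : ∀ V, ∀ r ∈ R', g' V r = 1 := by
    rintro V r ⟨y, rfl⟩
    exact combTransporter_embIter hk V y
  have hcov : ∀ (a : Site P 0 ⊕ PBond P k → Matrix.specialUnitaryGroup (Fin 2) ℂ), (∀ r ∈ R', a r = 1) →
      ∀ (V : PBond P 0 → Matrix.specialUnitaryGroup (Fin 2) ℂ) (x : Site P 0 ⊕ PBond P k),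
        g' (fun b => a (s' b) * V b * (a (t' b))⁻¹) x = g' V x * (a x)⁻¹ := by
    intro a ha V x
    have hroot : ∀ y : Site P k, a (Sum.inl (embIter k y)) = 1 := fun y => ha _ ⟨y, rfl⟩
    rcases x with x | c
    · show combTransporter k (fun b => a (s' b) * V b * (a (t' b))⁻¹) x = combTransporter k V x * (a (Sum.inl x))⁻¹
      have hE : ∀ b ∈ (combSet k : Set (PBond P 0)), (fun b => a (s' b) * V b * (a (t' b))⁻¹) b =
          GaugeField.gaugeAct (fun y => a (Sum.inl y)) V b := by
        intro b hb
        simp only [GaugeField.gaugeAct, hs'off b (hcombOff b hb), ht'off b (hcombOff b hb)]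
      rw [congrFun (combTransporter_congr hk hE) x, combTransporter_gaugeAct_of_rootTrivial k hroot V x]
    · show (a (s' (iterCentralBond (P := P) k c)) * V (iterCentralBond (P := P) k c) * (a (t' (iterCentralBond (P := P) k c)))⁻¹)⁻¹ =
        (V (iterCentralBond (P := P) k c))⁻¹ * (a (Sum.inr c))⁻¹
      rw [hs'piv, ht'piv, ha _ (hrootR _), inv_one, mul_one, mul_inv_rev]
  have hkill : ∀ V, ∀ b ∈ F', g' V (s' b) * V b * (g' V (t' b))⁻¹ = 1 := by
    intro V b hb
    rcases hb with hb | ⟨c, rfl⟩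
    · rw [hs'off b (hcombOff b hb), ht'off b (hcombOff b hb)]
      exact combTransporter_kill hk V hb
    · rw [hs'piv, ht'piv]
      show (V (iterCentralBond (P := P) k c))⁻¹ * V (iterCentralBond (P := P) k c) *
        (combTransporter k V (rootOf k (iterCentralBond (P := P) k c).tgt))⁻¹ = 1
      rw [inv_mul_cancel, one_mul, show rootOf k (iterCentralBond (P := P) k c).tgt =
        embIter k (blockIter k (iterCentralBond (P := P) k c).tgt) from rfl, combTransporter_embIter hk, inv_one]
  have hloc : ∀ V V' : PBond P 0 → Matrix.specialUnitaryGroup (Fin 2) ℂ, (∀ b ∈ F', V b = V' b) → g' V = g' V' := by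
    intro V V' hVV
    funext i
    rcases i with x | c
    · exact congrFun (combTransporter_congr hk fun b hb => hVV b (Or.inl hb)) x
    · show (V (iterCentralBond (P := P) k c))⁻¹ = (V' (iterCentralBond (P := P) k c))⁻¹
      rw [hVV _ (Or.inr ⟨c, rfl⟩)]
  have hg1 : g' (fun _ => 1) = fun _ => 1 := by
    funext i
    rcases i with x | c
    · show combTransporter k (1 : GaugeField P 0 (Matrix.specialUnitaryGroup (Fin 2) ℂ)) x = 1
      rw [combTransporter_one]
    · exact inv_one
  -- THE GENERIC CHART
  obtain ⟨e, σ, UZ, UV, jZ, jV, hec, he0, heR, hsurj, hσc, hσ0, hσs, hσF, hσg, hF4, hσgr, hUZo, hUVo, h0Z, h0V, hinj, hopen, hF3,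
      hjZc, hjVc, hjZ0, hjV0, hjZpos, hjVpos, hF4b, hchart, hF5, hF6⟩ :=
    exists_tubularChart_of_treeGauge_local_cover hch hlie (HaarData.haar : Measure (Matrix.specialUnitaryGroup (Fin 2) ℂ)) s' t' R' F' g'
      eZ eV hgc hgR hcov hkill hloc hg1 U₀
  -- the action of record IS the generic gauge formula on the extended lattice
  have hkey : ∀ p : EuclideanSpace ℝ (Fin dZ) × EuclideanSpace ℝ (Fin dV),
      Function.extend (iterCentralBond (P := P) k) (fun c => e p.1 (Sum.inr c) * σ p.2 (iterCentralBond (P := P) k c))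
        (GaugeField.gaugeAct (fun x => e p.1 (Sum.inl x)) (σ p.2)) = fun b => e p.1 (s' b) * σ p.2 b * (e p.1 (t' b))⁻¹ := by
    intro p
    funext b
    by_cases hb : ∃ c, iterCentralBond (P := P) k c = b
    · obtain ⟨c, rfl⟩ := hb
      rw [hιinj.extend_apply, hs'piv, ht'piv, heR _ _ (hrootR _), inv_one, mul_one]
    · rw [Function.extend_apply' _ _ b hb, hs'off b hb, ht'off b hb]
      rfl
  have hΘ : (fun p : EuclideanSpace ℝ (Fin dZ) × EuclideanSpace ℝ (Fin dV) =>
      Function.extend (iterCentralBond (P := P) k)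
        (fun c => ((fun x : Site P 0 => e p.1 (Sum.inl x)), (fun c : PBond P k => e p.1 (Sum.inr c))).2 c *
          σ p.2 (iterCentralBond (P := P) k c))
        (GaugeField.gaugeAct ((fun x : Site P 0 => e p.1 (Sum.inl x)), (fun c : PBond P k => e p.1 (Sum.inr c))).1 (σ p.2))) =
      fun p => fun b => e p.1 (s' b) * σ p.2 b * (e p.1 (t' b))⁻¹ := by
    funext p; exact hkey p
  -- a ball in the residual window
  obtain ⟨ε, hε, hball⟩ := Metric.isOpen_iff.1 hUZo _ h0Z
  refine ⟨fun z => ((fun x : Site P 0 => e z (Sum.inl x)), (fun c : PBond P k => e z (Sum.inr c))), σ, eV, UZ, UV, jZ, jV, ε / 2,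
    ?_, ?_, ?_, ?_, hσc, hσ0, hσs, hσF, ?_, ?_, ?_, hUZo, hUVo, h0Z, h0V, by linarith, ?_, ?_, ?_, ?_,
    hjZc, hjVc, hjZ0, hjV0, hjZpos, hjVpos, hF4b, ?_, hF5, ?_⟩
  · -- `e` continuous
    exact (continuous_pi fun x => (continuous_apply _).comp hec).prodMk (continuous_pi fun c => (continuous_apply _).comp hec)
  · -- `e 0 = 1`
    simp only [he0, Pi.one_apply]; rfl
  · -- residual
    intro z y
    exact heR z _ ⟨y, rfl⟩
  · -- onto a neighbourhood of `(1, 1)` among the residual pairs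
    intro sZ hsZ
    obtain ⟨tt, htt, hsub⟩ := hsurj sZ hsZ
    set jn : (Site P 0 → Matrix.specialUnitaryGroup (Fin 2) ℂ) × (PBond P k → Matrix.specialUnitaryGroup (Fin 2) ℂ) →
        (Site P 0 ⊕ PBond P k → Matrix.specialUnitaryGroup (Fin 2) ℂ) := fun w => Sum.elim w.1 w.2 with hjn
    have hjnc : Continuous jn := by
      refine continuous_pi fun i => ?_
      rcases i with x | c
      · exact (continuous_apply x).comp continuous_fst
      · exact (continuous_apply c).comp continuous_snd
    have hjn1 : jn ((1 : Site P 0 → Matrix.specialUnitaryGroup (Fin 2) ℂ), (1 : PBond P k → Matrix.specialUnitaryGroup (Fin 2) ℂ)) = 1 := by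
      funext i; rcases i with x | c <;> rfl
    refine ⟨jn ⁻¹' tt, hjnc.continuousAt.preimage_mem_nhds (by rw [hjn1]; exact htt), ?_⟩
    intro w hw hwres
    have hR : ∀ r ∈ R', jn w r = 1 := by
      rintro r ⟨y, rfl⟩
      exact hwres y
    obtain ⟨z, hz, hzw⟩ := hsub (jn w) hw hR
    refine ⟨z, hz, ?_⟩
    refine Prod.ext (funext fun x => ?_) (funext fun c => ?_)
    · exact congrFun hzw (Sum.inl x)
    · exact congrFun hzw (Sum.inr c)
  · -- (A1) the comb transporter is constant along the transversal (`inl`-components of the generic (σ-transporter) row)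
    intro y
    funext x
    have h1 := congrFun (hσg y) (Sum.inl x)
    simpa only [hg', Sum.elim_inl] using h1
  · -- (F4a) the bondwise formula: off comb ∪ pivots `t' b = inl b₊` and `g' U₀ (inl x) = combTransporter k U₀ x`
    intro y b hb
    have hb' : b ∉ Set.range (iterCentralBond (P := P) k) := fun h => hb (Or.inr h)
    have h1 := hF4 y b hb
    rw [ht'off b hb'] at h1
    simpa only [hg', Sum.elim_inl] using h1
  · -- (A2) quadratic departure from the base point: the generic (σ-growth) row, the coordinate ratio being a conjugate of `U₀(b)⁻¹ σ y(b)`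
    obtain ⟨c, hc, hev⟩ := hσgr
    refine ⟨c, hc, ?_⟩
    filter_upwards [hev] with y hy
    refine hy.trans ?_
    have hT : g' (σ y) = g' U₀ := hσg y
    have hterm : ∀ b : {b // b ∉ F'},
        ‖(Literature.MathematicalPhysics.QuantumLattice.fundamentalRep (Fin 2)) ((g' U₀ (s' b) * U₀ b * (g' U₀ (t' b))⁻¹)⁻¹ * (g' (σ y) (s' b) * σ y b * (g' (σ y) (t' b))⁻¹)) - 1‖ ^ 2 =
          dist1 (σ y b * (U₀ b)⁻¹) ^ 2 := by
      intro b
      rw [hT]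
      show dist1 ((g' U₀ (s' b) * U₀ b * (g' U₀ (t' b))⁻¹)⁻¹ * (g' U₀ (s' b) * σ y b * (g' U₀ (t' b))⁻¹)) ^ 2 = _
      rw [show (g' U₀ (s' b) * U₀ b * (g' U₀ (t' b))⁻¹)⁻¹ * (g' U₀ (s' b) * σ y b * (g' U₀ (t' b))⁻¹) =
          g' U₀ (t' b) * ((U₀ b)⁻¹ * (σ y b * (U₀ b)⁻¹) * (U₀ b)⁻¹⁻¹) * (g' U₀ (t' b))⁻¹ by group,
        GaugeGroup.dist1_conj, GaugeGroup.dist1_conj]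
    calc ∑ b : {b // b ∉ F'},
          ‖(Literature.MathematicalPhysics.QuantumLattice.fundamentalRep (Fin 2)) ((g' U₀ (s' b) * U₀ b * (g' U₀ (t' b))⁻¹)⁻¹ * (g' (σ y) (s' b) * σ y b * (g' (σ y) (t' b))⁻¹)) - 1‖ ^ 2
        = ∑ b : {b // b ∉ F'}, dist1 (σ y b * (U₀ b)⁻¹) ^ 2 := Finset.sum_congr rfl fun b _ => hterm b
      _ = ∑ b ∈ Finset.univ.filter (fun b : PBond P 0 => b ∉ F'), dist1 (σ y b * (U₀ b)⁻¹) ^ 2 :=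
        (Finset.sum_subtype _ (fun b => by simp) (fun b : PBond P 0 => dist1 (σ y b * (U₀ b)⁻¹) ^ 2)).symm
      _ ≤ ∑ b : PBond P 0, dist1 (σ y b * (U₀ b)⁻¹) ^ 2 :=
        Finset.sum_le_sum_of_subset_of_nonneg (Finset.filter_subset _ _) fun _ _ _ => sq_nonneg _
  · -- (F1) the ball `closedBall 0 (ε/2)` lies in `UZ`
    intro z hz
    rw [Metric.mem_closedBall, dist_zero_right] at hz
    apply hball
    rw [Metric.mem_ball, dist_zero_right]
    linarith
  · -- injectivity on the window
    rw [hΘ]; exact hinj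
  · -- openness at the origin
    rw [hΘ]; exact hopen
  · -- (F3) openness at every point of the window
    rw [hΘ]; exact hF3
  · -- THE CHART IDENTITY (`fieldMeasure = ⊗ Haar` is `rfl`)
    rw [hΘ]; exact hchart
  · -- (F6) THE COVER ROW in lattice currency: off comb ∪ pivots `s' b = inl b₋`, `t' b = inl b₊`, `g' V (inl x) = combTransporter k V x`;
    -- the residual factor `(T_{V'})⁻¹ T_{U₀}` is root-trivial (`combTransporter_embIter`), the pivot factor is `V'(ι c) U₀(ι c)⁻¹` ((σ-comb) on the pivots)
    intro V' hV'
    obtain ⟨y, hy, hEq⟩ := hF6 V' (fun b hb => by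
      have hb' : b ∉ Set.range (iterCentralBond (P := P) k) := fun h => hb (Or.inr h)
      rw [hs'off b hb', ht'off b hb']
      simpa only [hg', Sum.elim_inl] using hV' b hb)
    refine ⟨y, hy, ?_⟩
    conv_lhs => rw [hEq]
    funext b
    by_cases hb : ∃ c, iterCentralBond (P := P) k c = b
    · obtain ⟨c, rfl⟩ := hb
      have hr : combTransporter k V' (rootOf k (iterCentralBond (P := P) k c).tgt) = 1 ∧
          combTransporter k U₀ (rootOf k (iterCentralBond (P := P) k c).tgt) = 1 :=
        ⟨combTransporter_embIter hk V' _, combTransporter_embIter hk U₀ _⟩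
      rw [hιinj.extend_apply, hs'piv, ht'piv, hσF y _ (Or.inr ⟨c, rfl⟩)]
      simp only [hg', Sum.elim_inl, Sum.elim_inr, inv_inv, hr.1, hr.2, inv_one, mul_one]
    · rw [Function.extend_apply' _ _ b hb, hs'off b hb, ht'off b hb]
      rfl

end Summit.QuantumFields.YangMills.Theorems.FluctuationComparisonRegPrIntLS2BetaTubularChartActLocalWinId

end
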